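import Summits.Ventures.PercRepro.Night2LocalD2R14LargeCoColoop

/-!
# PercRepro — the six-element columns of R1₄ with two far preimages (night-2, gen 16)

At a shadow set `S` with `|S| = 6` of the coloop cell, two far preimages `B₁ ≠ B₂` (pair sets `X₁ = {a, b}`,
`X₂ = {a, c}`, which meet by `not_sdiff_subset_clF_of_far`) confine everything (proofs/NIGHT-2-k1.md §7.0 (U1)):
the set `(G ∖ S) ∪ {w}` has rank `≤ 2` for every `w ∈ B₁ ∩ B₂ ∖ {y}` (it lies in `(cl B₁ ∩ cl B₂) ∖ {y}`, and `y`
is a coloop of the rank-`≤ 3` flat `cl B₁ ∩ cl B₂`), so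

* every pair set lies in `X₁ ∪ X₂` (`sdiff_subset_union_of_two_far`): a pair `{e, w}` with `w ∉ X₁ ∪ X₂` would have
  `ρ(E ∖ B) ≤ 5`; hence `#pairPre ≤ 3`;
* no basis spreads (`r14Spread_eq_zero_of_two_far`): every basis `S ∖ {x, y}` has a face `S ∖ {x, z}`, `z ∈ S ∖ (X₁ ∪ X₂ ∪ {y})`,
  that is not a member, so `σ⁺ ≤ 18/35 < 3/5` and it keeps `2/5`;
* the identity and covering parts vanish (gen 15).

**`sum_r14W_col_le_of_card_six_of_two_far`**: the column is `≤ 21/25 ≤ 1`.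
-/

namespace PercRepro.Shadow

open Finset PerFlat ThmH

variable {α : Type*} [DecidableEq α] {M : Matroid α} [M.Finite]

open scoped Classical in
/-- `(G ∖ S) ∪ {w}` has rank `≤ 2` for two distinct far preimages `B₁ ≠ B₂` of `S` and `w ∈ B₁ ∩ B₂`, `w ≠ y`. -/
theorem rkN_sdiff_union_le_two_of_two_far {G : Finset α} (hG : G ∈ flatsQ M (4 + 1)) {y : α} (hyG : y ∈ G)
    (hyc : y ∉ clF M (G.erase y)) {S B₁ B₂ : Finset α} (h₁ : B₁ ∈ opFarPre M G S) (h₂ : B₂ ∈ opFarPre M G S)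
    (hne : B₁ ≠ B₂) {w : α} (hw₁ : w ∈ B₁) (hw₂ : w ∈ B₂) (hwy : w ≠ y) : rkN M ((G \ S) ∪ {w}) ≤ 2 := by
  have hGg : G ⊆ gr M := (mem_flatsQ.1 hG).1
  have hU₁ : B₁ ∈ Uq M (4 + 2) 4 := (mem_membersIn.1 (mem_opFarPre.1 h₁).1).1
  have hU₂ : B₂ ∈ Uq M (4 + 2) 4 := (mem_membersIn.1 (mem_opFarPre.1 h₂).1).1
  have hy₁ := mem_of_mem_opFarPre hG hyG hyc h₁
  have hy₂ := mem_of_mem_opFarPre hG hyG hyc h₂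
  set I := clF M B₁ ∩ clF M B₂ with hIdef
  have hIG : I ⊆ G := Finset.inter_subset_left.trans (mem_membersIn.1 (mem_opFarPre.1 h₁).1).2
  have hyI : y ∈ I := Finset.mem_inter.2 ⟨subset_clF hU₁ hy₁, subset_clF hU₂ hy₂⟩
  have hI3 : rkN M I ≤ 3 := rkN_inter_clF_le_three_of_opFarPre hG h₁ h₂ hne
  -- `ρ(I ∖ y) ≤ 2`
  have hIe : rkN M (I.erase y) ≤ 2 := by
    have h := rkN_insert_coloop_eq hGg hyG hyc (Finset.erase_subset_erase _ hIG : I.erase y ⊆ G.erase y)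
    rw [Finset.insert_erase hyI] at h
    omega
  have hsub : (G \ S) ∪ {w} ⊆ I.erase y := by
    intro e he
    rw [Finset.mem_union, Finset.mem_singleton] at he
    rw [Finset.mem_erase]
    rcases he with he | rfl
    · rw [Finset.mem_sdiff] at he
      exact ⟨fun h => he.2 (h ▸ subset_of_mem_opFarPre h₁ hy₁),
        Finset.mem_inter.2 ⟨sdiff_subset_clF_of_mem_opFarPre h₁ (Finset.mem_sdiff.2 he),
          sdiff_subset_clF_of_mem_opFarPre h₂ (Finset.mem_sdiff.2 he)⟩⟩
    · exact ⟨hwy, Finset.mem_inter.2 ⟨subset_clF hU₁ hw₁, subset_clF hU₂ hw₂⟩⟩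
  exact (rkN_mono (M := M) hsub).trans hIe

open scoped Classical in
/-- A set `F ⊆ G` with `G ∖ F ⊆ (G ∖ S) ∪ {w, x}` and `ρ((G ∖ S) ∪ {w}) ≤ 2` is not a bottom set (`|E ∖ G| = 2`). -/
theorem notMem_Uq_of_sdiff_subset {G : Finset α} (hd : (gr M \ G).card = 2) {S F : Finset α} {w x : α}
    (hr : rkN M ((G \ S) ∪ {w}) ≤ 2) (hsub : G \ F ⊆ (G \ S) ∪ {w} ∪ {x}) : F ∉ Uq M (4 + 2) 4 := by
  intro hF
  have h6 := rkN_sdiff_eq_of_mem_Uq hF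
  have h1 : gr M \ F ⊆ ((G \ S) ∪ {w} ∪ {x}) ∪ (gr M \ G) := by
    intro e he
    rw [Finset.mem_sdiff] at he
    rw [Finset.mem_union]
    by_cases heG : e ∈ G
    · exact Or.inl (hsub (Finset.mem_sdiff.2 ⟨heG, he.2⟩))
    · exact Or.inr (Finset.mem_sdiff.2 ⟨he.1, heG⟩)
  have h2 := rkN_mono (M := M) h1
  have h3 := rkN_union_le_rkN_add_card (M := M) ((G \ S) ∪ {w} ∪ {x}) (gr M \ G)
  have h4 := rkN_union_le_rkN_add_card (M := M) ((G \ S) ∪ {w}) {x}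
  rw [Finset.card_singleton] at h4
  omega

open scoped Classical in
/-- **With two far preimages every pair set lies in `X₁ ∪ X₂`.** -/
theorem sdiff_subset_union_of_two_far {G : Finset α} (hG : G ∈ flatsQ M (4 + 1)) (hd : (gr M \ G).card = 2)
    {y : α} (hyG : y ∈ G) (hyc : y ∉ clF M (G.erase y)) {S B₁ B₂ : Finset α} (h₁ : B₁ ∈ opFarPre M G S)
    (h₂ : B₂ ∈ opFarPre M G S) (hne : B₁ ≠ B₂) {B : Finset α} (hB : B ∈ pairPre M 4 G S) :
    S \ B ⊆ (S \ B₁) ∪ (S \ B₂) := by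
  intro w hw
  by_contra hw'
  rw [Finset.mem_union, not_or] at hw'
  have hwS : w ∈ S := (Finset.mem_sdiff.1 hw).1
  have hw₁ : w ∈ B₁ := by
    by_contra h
    exact hw'.1 (Finset.mem_sdiff.2 ⟨hwS, h⟩)
  have hw₂ : w ∈ B₂ := by
    by_contra h
    exact hw'.2 (Finset.mem_sdiff.2 ⟨hwS, h⟩)
  have hwy : w ≠ y := fun h => (Finset.mem_sdiff.1 hw).2 (h ▸ mem_of_mem_pairPre hG hyG hyc hB)
  have hr := rkN_sdiff_union_le_two_of_two_far hG hyG hyc h₁ h₂ hne hw₁ hw₂ hwy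
  -- the other point `e` of the pair set lies in `X₁`
  obtain ⟨e, heX, hecl⟩ := Finset.not_subset.1 (not_sdiff_subset_clF_of_far hG hd hyG hyc h₁ hB)
  have hsub : G \ B ⊆ (G \ S) ∪ {w} ∪ {e} := by
    intro t ht
    rw [Finset.mem_sdiff] at ht
    rw [Finset.mem_union, Finset.mem_union, Finset.mem_singleton, Finset.mem_singleton]
    by_cases htS : t ∈ S
    · have htX : t ∈ S \ B := Finset.mem_sdiff.2 ⟨htS, ht.2⟩
      -- the pair set has two elements `w ≠ e`
      have hc := card_sdiff_of_mem_pairPre hB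
      have hU₁ : B₁ ∈ Uq M (4 + 2) 4 := (mem_membersIn.1 (mem_opFarPre.1 h₁).1).1
      have hwe : w ≠ e := fun h => hecl (h ▸ subset_clF hU₁ hw₁)
      have hXeq : S \ B = {w, e} :=
        (Finset.eq_of_subset_of_card_le (Finset.insert_subset hw (Finset.singleton_subset_iff.2 heX))
          (by rw [hc, Finset.card_pair hwe])).symm
      rw [hXeq, Finset.mem_insert, Finset.mem_singleton] at htX
      rcases htX with rfl | rfl
      · exact Or.inl (Or.inr rfl)
      · exact Or.inr rfl
    · exact Or.inl (Or.inl (Finset.mem_sdiff.2 ⟨ht.1, htS⟩))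
  exact notMem_Uq_of_sdiff_subset hd hr hsub (mem_membersIn.1 (mem_pairPre.1 hB).1).1

open scoped Classical in
/-- **With two far preimages there are at most three pair preimages** (the pair sets are 2-subsets of the 3-set
`X₁ ∪ X₂`). -/
theorem card_pairPre_le_three_of_two_far {G : Finset α} (hG : G ∈ flatsQ M (4 + 1)) (hd : (gr M \ G).card = 2)
    {y : α} (hyG : y ∈ G) (hyc : y ∉ clF M (G.erase y)) {S B₁ B₂ : Finset α} (h₁ : B₁ ∈ opFarPre M G S)
    (h₂ : B₂ ∈ opFarPre M G S) (hne : B₁ ≠ B₂) : (pairPre M 4 G S).card ≤ 3 := by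
  have hp₁ : B₁ ∈ pairPre M 4 G S := opFarPre_subset_pairPre G S h₁
  have hp₂ : B₂ ∈ pairPre M 4 G S := opFarPre_subset_pairPre G S h₂
  -- `|X₁ ∪ X₂| = 3`
  have hmeet : ∃ e ∈ S \ B₂, e ∈ S \ B₁ := by
    obtain ⟨e, heX, hecl⟩ := Finset.not_subset.1 (not_sdiff_subset_clF_of_far hG hd hyG hyc h₁ hp₂)
    exact ⟨e, heX, Finset.mem_sdiff.2 ⟨(Finset.mem_sdiff.1 heX).1,
      fun h => hecl (subset_clF (mem_membersIn.1 (mem_opFarPre.1 h₁).1).1 h)⟩⟩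
  have hXne := sdiff_ne_of_mem_pairPre hp₁ hp₂ hne
  have hc₁ := card_sdiff_of_mem_pairPre hp₁
  have hc₂ := card_sdiff_of_mem_pairPre hp₂
  have hU3 : ((S \ B₁) ∪ (S \ B₂)).card ≤ 3 := by
    have hu := Finset.card_union_add_card_inter (S \ B₁) (S \ B₂)
    obtain ⟨e, he₂, he₁⟩ := hmeet
    have hpos : 0 < ((S \ B₁) ∩ (S \ B₂)).card := Finset.card_pos.2 ⟨e, Finset.mem_inter.2 ⟨he₁, he₂⟩⟩
    omega
  -- the pair sets are 2-subsets of `X₁ ∪ X₂`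
  have hmaps : ∀ B ∈ pairPre M 4 G S, S \ B ∈ Finset.powersetCard 2 ((S \ B₁) ∪ (S \ B₂)) := by
    intro B hB
    rw [Finset.mem_powersetCard]
    exact ⟨sdiff_subset_union_of_two_far hG hd hyG hyc h₁ h₂ hne hB, card_sdiff_of_mem_pairPre hB⟩
  have hinj : Set.InjOn (fun B => S \ B) (pairPre M 4 G S : Set (Finset α)) := by
    intro B hB B' hB' h
    by_contra hne'
    exact sdiff_ne_of_mem_pairPre (Finset.mem_coe.1 hB) (Finset.mem_coe.1 hB') hne' h
  have h1 := Finset.card_le_card_of_injOn (fun B => S \ B) hmaps hinj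
  have h2 : (Finset.powersetCard 2 ((S \ B₁) ∪ (S \ B₂))).card ≤ 3 := by
    rw [Finset.card_powersetCard]
    have : ((S \ B₁) ∪ (S \ B₂)).card.choose 2 ≤ Nat.choose 3 2 := Nat.choose_le_choose 2 hU3
    simpa using this
  omega

/-! ## No basis spreads -/

open scoped Classical in
/-- **With two far preimages at `|S| = 6`, the spread part vanishes**: every basis `S ∖ {x, y}` has a face
`S ∖ {x, z₀}` (`z₀ ∈ S ∖ (X₁ ∪ X₂ ∪ {x, y})`) that is not a member, so its `σ⁺ ≤ 18/35` and it keeps `2/5`. -/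
theorem r14Spread_eq_zero_of_two_far {G : Finset α} (hG : G ∈ flatsQ M (4 + 1)) (hd : (gr M \ G).card = 2)
    {y : α} (hyG : y ∈ G) (hyc : y ∉ clF M (G.erase y)) (hP : ∀ z ∈ G.erase y, 4 ≤ rkN M ((G.erase y).erase z))
    {S : Finset α} (h6 : S.card = 6) {B₁ B₂ : Finset α} (h₁ : B₁ ∈ opFarPre M G S) (h₂ : B₂ ∈ opFarPre M G S)
    (hne : B₁ ≠ B₂) : r14Spread M G S = 0 := by
  have hGg : G ⊆ gr M := (mem_flatsQ.1 hG).1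
  have hp₁ : B₁ ∈ pairPre M 4 G S := opFarPre_subset_pairPre G S h₁
  have hp₂ : B₂ ∈ pairPre M 4 G S := opFarPre_subset_pairPre G S h₂
  have hU₁ : B₁ ∈ Uq M (4 + 2) 4 := (mem_membersIn.1 (mem_opFarPre.1 h₁).1).1
  -- `|X₁ ∪ X₂| ≤ 3`
  have hU3 : ((S \ B₁) ∪ (S \ B₂)).card ≤ 3 := by
    obtain ⟨e, heX, hecl⟩ := Finset.not_subset.1 (not_sdiff_subset_clF_of_far hG hd hyG hyc h₁ hp₂)
    have he₁ : e ∈ S \ B₁ := Finset.mem_sdiff.2 ⟨(Finset.mem_sdiff.1 heX).1, fun h => hecl (subset_clF hU₁ h)⟩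
    have hu := Finset.card_union_add_card_inter (S \ B₁) (S \ B₂)
    have hpos : 0 < ((S \ B₁) ∩ (S \ B₂)).card := Finset.card_pos.2 ⟨e, Finset.mem_inter.2 ⟨he₁, heX⟩⟩
    have hc₁ := card_sdiff_of_mem_pairPre hp₁
    have hc₂ := card_sdiff_of_mem_pairPre hp₂
    omega
  unfold r14Spread
  apply Finset.sum_eq_zero
  intro B hB
  apply Finset.sum_eq_zero
  intro x hx
  split_ifs with hSx
  · rw [Finset.mem_filter] at hB
    obtain ⟨hBm, hm1, hB5⟩ := hB
    have hBU : B ∈ Uq M (4 + 2) 4 := (mem_membersIn.1 hBm).1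
    have hBG : B ⊆ G := (subset_clF hBU).trans (mem_membersIn.1 hBm).2
    -- `G ∖ cl B = {y}`
    have hyB : y ∉ B := by
      intro hyB
      have := two_le_card_sdiff_clF_of_mem_coloop hG hyG hyc hP hBm hyB
      omega
    have hBy : B ⊆ G.erase y := fun e he => Finset.mem_erase.2 ⟨fun h => hyB (h ▸ he), hBG he⟩
    have hGy : G \ clF M B = {y} := sdiff_clF_eq_singleton_of_subset_erase hG hyG hyc hBm hBy
    rw [hGy] at hSx
    have hxB : x ∉ B := (Finset.mem_sdiff.1 hx).2
    have hxy : x ≠ y := by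
      intro h
      have hx' : x ∈ G \ clF M B := by
        rw [hGy, h]
        exact Finset.mem_singleton_self _
      exact (Finset.mem_sdiff.1 hx').2 (Finset.mem_sdiff.1 hx).1
    have hxBy : x ∉ B ∪ {y} := by
      rw [Finset.mem_union, Finset.mem_singleton, not_or]
      exact ⟨hxB, hxy⟩
    have hB4 : B.card = 4 := by
      have h1 : S.card = (B ∪ {y}).card + 1 := by rw [hSx, Finset.card_insert_of_notMem hxBy]
      have h2 : (B ∪ {y}).card = B.card + 1 := by
        rw [Finset.card_union_of_disjoint (Finset.disjoint_singleton_right.2 hyB), Finset.card_singleton]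
      omega
    -- the point `z₀`
    obtain ⟨z₀, hz₀⟩ : (S \ ((S \ B₁) ∪ (S \ B₂) ∪ {y} ∪ {x})).Nonempty := by
      apply Finset.card_pos.1
      have h1 := Finset.card_sdiff_add_card_inter S ((S \ B₁) ∪ (S \ B₂) ∪ {y} ∪ {x})
      have h2 : (S ∩ ((S \ B₁) ∪ (S \ B₂) ∪ {y} ∪ {x})).card ≤ 5 := by
        calc (S ∩ ((S \ B₁) ∪ (S \ B₂) ∪ {y} ∪ {x})).card ≤ ((S \ B₁) ∪ (S \ B₂) ∪ {y} ∪ {x}).card :=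
              Finset.card_le_card Finset.inter_subset_right
          _ ≤ ((S \ B₁) ∪ (S \ B₂) ∪ {y}).card + 1 := by
              have := Finset.card_union_le ((S \ B₁) ∪ (S \ B₂) ∪ {y}) {x}
              rw [Finset.card_singleton] at this
              exact this
          _ ≤ ((S \ B₁) ∪ (S \ B₂)).card + 1 + 1 := by
              have := Finset.card_union_le ((S \ B₁) ∪ (S \ B₂)) {y}
              rw [Finset.card_singleton] at this
              omega
          _ ≤ 5 := by omega
      omega
    rw [Finset.mem_sdiff, Finset.mem_union, Finset.mem_union, Finset.mem_union, Finset.mem_singleton,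
      Finset.mem_singleton, not_or, not_or, not_or] at hz₀
    obtain ⟨hz₀S, ⟨⟨hz₀₁, hz₀₂⟩, hz₀y⟩, hz₀x⟩ := hz₀
    have hz₀B₁ : z₀ ∈ B₁ := by
      by_contra h
      exact hz₀₁ (Finset.mem_sdiff.2 ⟨hz₀S, h⟩)
    have hz₀B₂ : z₀ ∈ B₂ := by
      by_contra h
      exact hz₀₂ (Finset.mem_sdiff.2 ⟨hz₀S, h⟩)
    have hz₀B : z₀ ∈ B := by
      rw [hSx, Finset.mem_insert, Finset.mem_union, Finset.mem_singleton] at hz₀S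
      rcases hz₀S with h | h | h
      · exact absurd h hz₀x
      · exact h
      · exact absurd h hz₀y
    -- the face at `z₀` is not a member
    have hr := rkN_sdiff_union_le_two_of_two_far hG hyG hyc h₁ h₂ hne hz₀B₁ hz₀B₂ hz₀y
    have hface : (B.erase z₀) ∪ (G \ clF M B) ∉ membersIn M (Uq M (4 + 2) 4) G := by
      intro hmem
      apply notMem_Uq_of_sdiff_subset hd hr (S := S) (w := z₀) (x := x) _ (mem_membersIn.1 hmem).1
      intro t ht
      rw [Finset.mem_sdiff, hGy, Finset.mem_union, Finset.mem_erase, Finset.mem_singleton, not_or,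
        not_and] at ht
      rw [Finset.mem_union, Finset.mem_union, Finset.mem_singleton, Finset.mem_singleton]
      by_cases htS : t ∈ S
      · rw [hSx, Finset.mem_insert, Finset.mem_union, Finset.mem_singleton] at htS
        rcases htS with h | h | h
        · exact Or.inr h
        · by_cases htz : t = z₀
          · exact Or.inl (Or.inr htz)
          · exact absurd h (ht.2.1 htz)
        · exact absurd h ht.2.2
      · exact Or.inl (Or.inl (Finset.mem_sdiff.2 ⟨ht.1, htS⟩))
    -- `σ⁺(B) ≤ 18/35`
    have hsig : r14Sigma M G B ≤ 18 / 35 := by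
      unfold r14Sigma
      have hterm : ∀ z ∈ B, (if (B.erase z) ∪ (G \ clF M B) ∈ membersIn M (Uq M (4 + 2) 4) G then
          r14Cov M G ((B.erase z) ∪ (G \ clF M B)) else 0) ≤ (if z = z₀ then 0 else 6 / 35) := by
        intro z _
        by_cases hz : z = z₀
        · subst hz
          simp only [hface, if_false, if_true, le_refl]
        · simp only [hz, if_false]
          split_ifs
          · exact r14Cov_le _ _
          · norm_num
      calc ∑ z ∈ B, (if (B.erase z) ∪ (G \ clF M B) ∈ membersIn M (Uq M (4 + 2) 4) G then
            r14Cov M G ((B.erase z) ∪ (G \ clF M B)) else 0)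
          ≤ ∑ z ∈ B, (if z = z₀ then (0 : ℚ) else 6 / 35) := Finset.sum_le_sum hterm
        _ = ∑ z ∈ B.erase z₀, (if z = z₀ then (0 : ℚ) else 6 / 35) := by
            rw [Finset.sum_erase]
            simp
        _ = 18 / 35 := by
            rw [Finset.sum_congr rfl (fun z hz => if_neg (Finset.ne_of_mem_erase hz)), Finset.sum_const,
              Finset.card_erase_of_mem hz₀B, hB4]
            norm_num
    have hkeep : r14Keep M G B = 2 / 5 := by
      unfold r14Keep
      rw [min_eq_left (by linarith), max_eq_right (by norm_num)]
    rw [hkeep, sub_self, zero_div]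
  · rfl

/-! ## The column -/

open scoped Classical in
/-- **The column of R1₄ at a six-element shadow set with two far preimages is at most `21/25`.** -/
theorem sum_r14W_col_le_of_card_six_of_two_far {G : Finset α} (hG : G ∈ flatsQ M (4 + 1))
    (hd : (gr M \ G).card = 2) {y : α} (hyG : y ∈ G) (hyc : y ∉ clF M (G.erase y))
    (hP : ∀ z ∈ G.erase y, 4 ≤ rkN M ((G.erase y).erase z)) {S : Finset α} (h6 : S.card = 6)
    (h2 : 2 ≤ (opFarPre M G S).card) : ∑ B ∈ membersIn M (Uq M (4 + 2) 4) G, r14W M G B S ≤ 1 := by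
  obtain ⟨B₁, B₂, hB₁, hB₂, hne⟩ := Finset.one_lt_card_iff.1 (show 1 < (opFarPre M G S).card by omega)
  have hparts := sum_r14W_col_le_parts (M := M) G S
  rw [r14KeepPre_eq_empty (by omega), Finset.sum_empty, r14IdPre_eq_empty_of_two_far hG hd h2,
    r14CovPre_eq_empty_of_two_far hG hd h2, Finset.sum_empty, Finset.card_empty,
    r14Spread_eq_zero_of_two_far hG hd hyG hyc hP h6 hB₁ hB₂ hne, r14PairPre_eq_pairPre] at hparts
  have hpair := sum_r14Pair_le (M := M) G S
  have hp := card_pairPre_le_three_of_two_far hG hd hyG hyc hB₁ hB₂ hne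
  have hfp : (opFarPre M G S).card ≤ (pairPre M 4 G S).card :=
    Finset.card_le_card (opFarPre_subset_pairPre G S)
  have hnat : 5 * (opFarPre M G S).card + 2 * (pairPre M 4 G S).card ≤ 21 := by omega
  have hq : ((5 * (opFarPre M G S).card + 2 * (pairPre M 4 G S).card : ℕ) : ℚ) ≤ 21 := by exact_mod_cast hnat
  push_cast at hq
  simp only [Nat.cast_zero, zero_mul, zero_add] at hparts
  linarith

end PercRepro.Shadow
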